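/-
COR-CM (cell pub-hodgecm2, stage 2 of the Hodge ladder) — count-neutral KERNEL COMBINATORICS «the binary tetrahedral group SL(2,3)», part IIIa: COUNTING in order 24 (seat prover-pub-hodgecm2-b23-g53-0, binder prover b23, gen 53; claim HOME/INBOX.md l.24246, NAME ASK l.24300, lead ACK
l.24306).  Theorems only, on parts I–II, this seatʼs `Census/SylowTransfer{ShearedElements,EightPrimeAll}.lean` and gen 51ʼs parts VII/XI BY NAME; `decide`
only on closed numerals, no certificate, no named fact, no `sorry`; `Interfaces.lean` (C1), every E term, B01, `Transposition/*`, `PortJoin/*`, `D2Bridge/*` untouched.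
HONEST FRAMING: `HC_CM` is NOT proved, here or anywhere in the tree; nothing here is a period, a count of record or a headline.
-/
import Summits.HodgeConjecture.CorCM.Census.BinaryTetrahedralDatum
import Summits.HodgeConjecture.CorCM.Census.SylowTransferEightPrimeAll

/-!
# The binary tetrahedral group, IIIa: counting in order `24`

* §1 **Counting in order `24`**: `|G| = 24`, `c` a central involution, `z` of order `3` with `⟨z⟩` NOT normal ⟹ four Sylow `3`-subgroups
  (`card_sylow_three_eq_four`), hence `≥ 8` elements of order `3` and `≥ 8` of order `6` (`c·z'`), so at most `8` elements of `2`-power order: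
  **the Sylow `2`-subgroup is normal** (`conj_mem_sylow_two`) — classification-free (no `A₄`, no `S₄`).
* §2 **Two lemmas on elements of order `3`**: such an element inverts only involutions (`mul_self_eq_one_of_orderOf_three_of_conj_eq_inv`); if it
  normalises a subgroup `P` of order `8` and centralises an element of order `4` of `P` then it centralises `P`
  (`conj_eq_self_of_centralises_orderOf_four`), and an element of order `3` centralising a subgroup of order `8` in a group of order `24` is central
  (`commute_of_centralises_card_eight`).  Part IIIb (`Census/BinaryTetrahedralDichotomy.lean`) builds the datum and the dichotomies on these.
All [folklore] bookkeeping over [Pohlmann1968, Thm 1] in the reading of [Milne1999, Prop. 2.1].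

## References
* [Pohlmann1968] H. Pohlmann, Algebraic cycles on abelian varieties of complex multiplication type, Ann. of Math. 88 (1968), Thm 1.
* [Milne1999] J. S. Milne, Lefschetz motives and the Tate conjecture, Compositio Math. 117 (1999), Prop. 2.1, p. 54.
-/

namespace Summit.HodgeConjecture.CorCM.Census.BinaryTetrahedral

open Finset
open Summit.HodgeConjecture.CorCM.Prior.AllgGroup.RfwfAllgGroup
open Summit.HodgeConjecture.CorCM.Census.BlockParity
open Summit.HodgeConjecture.CorCM.Census.Coinvariant
open Summit.HodgeConjecture.CorCM.Census.TypeStabiliser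
open Summit.HodgeConjecture.CorCM.Census.SylowTransfer

noncomputable section

variable {G : Type*} [Group G] [Fintype G] [DecidableEq G]

/-! ## §1 Counting in order `24`: the Sylow `2`-subgroup is normal -/

/-- `(24).factorization 3 = 1`. [folklore] -/
private theorem factorization_twentyfour_three : (24 : ℕ).factorization 3 = 1 := by
  rw [show (24 : ℕ) = 8 * 3 ^ 1 by norm_num, factorization_eight_mul_prime_pow Nat.prime_three (by norm_num)]

omit [DecidableEq G] in
/-- **`|G| = 24`, `ord z = 3`, `⟨z⟩` not normal ⟹ there are exactly four Sylow `3`-subgroups** (`n₃ ∣ 8`, `n₃ ≡ 1 (mod 3)`, `n₃ ≠ 1`). [folklore] -/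
theorem card_sylow_three_eq_four (hG : Fintype.card G = 24) {z : G} (hz : orderOf z = 3)
    (hzn : ∃ w : G, w * z * w⁻¹ ∉ Subgroup.zpowers z) : Nat.card (Sylow 3 G) = 4 := by
  classical
  haveI : Fact (Nat.Prime 3) := ⟨Nat.prime_three⟩
  have hfac : (Nat.card G).factorization 3 = 1 := by rw [Nat.card_eq_fintype_card (α := G), hG, factorization_twentyfour_three]
  set Q : Sylow 3 G := Sylow.ofCard (Subgroup.zpowers z) (by rw [Nat.card_zpowers, hz, hfac, pow_one]) with hQ
  have hQz : (Q : Subgroup G) = Subgroup.zpowers z := rfl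
  have hQidx : (Q : Subgroup G).index = 8 := by
    have h := (Q : Subgroup G).card_mul_index
    rw [hQz, Nat.card_zpowers, hz, Nat.card_eq_fintype_card (α := G), hG] at h
    rw [hQz]; omega
  set N := Subgroup.normalizer ((Q : Subgroup G) : Set G) with hN
  have hn : Nat.card (Sylow 3 G) = N.index := Q.card_eq_index_normalizer
  have hdvd : N.index ∣ 8 := by rw [← hn, ← hQidx]; exact Q.card_dvd_index
  have hmod : N.index % 3 = 1 := by
    have h : N.index ≡ 1 [MOD 3] := by rw [← hn]; exact card_sylow_modEq_one 3 G
    exact h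
  have hN1 : N.index ≠ 1 := by
    intro h1
    have hNtop : N = ⊤ := Subgroup.index_eq_one.mp h1
    have hnormal : (Q : Subgroup G).Normal := Subgroup.normalizer_eq_top_iff.mp hNtop
    obtain ⟨w, hw⟩ := hzn
    exact hw (hnormal.conj_mem z (Subgroup.mem_zpowers z) w)
  obtain ⟨i, hi, hNi⟩ := (Nat.dvd_prime_pow Nat.prime_two).mp (show N.index ∣ 2 ^ 3 by simpa using hdvd)
  rw [hn]
  interval_cases i
  · exact absurd (by simpa using hNi) hN1
  · rw [hNi] at hmod; norm_num at hmod
  · rw [hNi]; norm_num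
  · rw [hNi] at hmod; norm_num at hmod

omit [DecidableEq G] in
/-- Every Sylow `3`-subgroup of a group of order `24` has order `3`. [folklore] -/
theorem card_sylow_three (hG : Fintype.card G = 24) (R : Sylow 3 G) : Nat.card (R : Subgroup G) = 3 := by
  haveI : Fact (Nat.Prime 3) := ⟨Nat.prime_three⟩
  rw [Sylow.card_eq_multiplicity, Nat.card_eq_fintype_card (α := G), hG, factorization_twentyfour_three, pow_one]

/-- **At least eight elements of order `3`** when `⟨z⟩` is not normal (two generators in each of the four Sylow `3`-subgroups). [folklore] -/
theorem eight_le_card_orderOf_eq_three (hG : Fintype.card G = 24) {z : G} (hz : orderOf z = 3)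
    (hzn : ∃ w : G, w * z * w⁻¹ ∉ Subgroup.zpowers z) : 8 ≤ (univ.filter (fun g : G => orderOf g = 3)).card := by
  classical
  haveI : Fact (Nat.Prime 3) := ⟨Nat.prime_three⟩
  have h4 := card_sylow_three_eq_four hG hz hzn
  have hcardR := card_sylow_three hG
  -- a non-identity element in each Sylow `3`-subgroup
  have hgen : ∀ R : Sylow 3 G, ∃ g : G, g ∈ (R : Subgroup G) ∧ g ≠ 1 := fun R => by
    by_contra h
    push Not at h
    have hbot : (R : Subgroup G) = ⊥ := (Subgroup.eq_bot_iff_forall _).mpr h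
    have := hcardR R
    rw [hbot, Subgroup.card_bot] at this
    omega
  choose gen hgen_mem hgen_ne using hgen
  have hord : ∀ R, orderOf (gen R) = 3 := fun R => by
    have hdvd : orderOf (gen R) ∣ 3 := by
      have h := (R : Subgroup G).orderOf_dvd_natCard (hgen_mem R)
      rwa [hcardR R] at h
    rcases (Nat.dvd_prime Nat.prime_three).mp hdvd with h | h
    · exact absurd (orderOf_eq_one_iff.mp h) (hgen_ne R)
    · exact h
  have hord' : ∀ (R : Sylow 3 G) (e : Fin 2), orderOf (gen R ^ ((e : ℕ) + 1)) = 3 := fun R e => by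
    rw [Nat.Coprime.orderOf_pow (by rw [hord]; have := e.2; interval_cases (e : ℕ) <;> norm_num), hord]
  have hzp : ∀ R : Sylow 3 G, Subgroup.zpowers (gen R) = (R : Subgroup G) := fun R =>
    Subgroup.eq_of_le_of_card_ge ((Subgroup.zpowers_le).mpr (hgen_mem R)) (by rw [hcardR, Nat.card_zpowers, hord])
  have hzp' : ∀ (R : Sylow 3 G) (e : Fin 2), Subgroup.zpowers (gen R ^ ((e : ℕ) + 1)) = Subgroup.zpowers (gen R) := fun R e =>
    Subgroup.eq_of_le_of_card_ge (Subgroup.zpowers_le.mpr (Subgroup.pow_mem _ (Subgroup.mem_zpowers _) _))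
      (by rw [Nat.card_zpowers, Nat.card_zpowers, hord, hord'])
  -- the injection `Sylow 3 G × Fin 2 ↪ {g | ord g = 3}`
  let f : Sylow 3 G × Fin 2 → {g : G // orderOf g = 3} := fun Re => ⟨gen Re.1 ^ ((Re.2 : ℕ) + 1), hord' Re.1 Re.2⟩
  have hinj : Function.Injective f := by
    rintro ⟨R, e⟩ ⟨R', e'⟩ h
    have hval : gen R ^ ((e : ℕ) + 1) = gen R' ^ ((e' : ℕ) + 1) := congrArg Subtype.val h
    have hRR' : R = R' := by
      apply Sylow.ext
      rw [← hzp R, ← hzp R', ← hzp' R e, ← hzp' R' e', hval]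
    subst hRR'
    have hmod := pow_inj_mod.mp hval
    rw [hord, Nat.mod_eq_of_lt (show (e : ℕ) + 1 < 3 by omega), Nat.mod_eq_of_lt (show (e' : ℕ) + 1 < 3 by omega)] at hmod
    have : e = e' := Fin.ext (by omega)
    rw [this]
  have hle := Nat.card_le_card_of_injective f hinj
  rwa [Nat.card_prod, h4, Nat.card_eq_fintype_card (α := Fin 2), Fintype.card_fin, Nat.card_eq_fintype_card,
    Fintype.card_subtype] at hle

/-- **At least eight elements of order `6`**: `x ↦ c·x` maps the elements of order `3` injectively to elements of order `6`. [folklore] -/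
theorem eight_le_card_orderOf_eq_six (c : G) (hG : Fintype.card G = 24) {z : G} (hz : orderOf z = 3)
    (hzn : ∃ w : G, w * z * w⁻¹ ∉ Subgroup.zpowers z) (hc2 : c * c = 1) (hc1 : c ≠ 1) (hcen : ∀ w : G, w * c = c * w) :
    8 ≤ (univ.filter (fun g : G => orderOf g = 6)).card := by
  classical
  haveI : Fact (Nat.Prime 2) := ⟨Nat.prime_two⟩
  have hordc : orderOf c = 2 := orderOf_eq_prime (by rw [pow_two, hc2]) hc1
  refine le_trans (eight_le_card_orderOf_eq_three hG hz hzn) ?_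
  refine Finset.card_le_card_of_injOn (fun x => c * x) (fun x hx => ?_) (fun x _ y _ h => mul_left_cancel h)
  rw [Finset.mem_coe, Finset.mem_filter] at hx ⊢
  refine ⟨Finset.mem_univ _, ?_⟩
  have hcx : Commute c x := (hcen x).symm
  rw [hcx.orderOf_mul_eq_mul_orderOf_of_coprime (by rw [hordc, hx.2]; decide), hordc, hx.2]

/-- **THE SYLOW `2`-SUBGROUP IS NORMAL** when `|G| = 24`, `c` is a central involution and `⟨z⟩` (`ord z = 3`) is not normal: the `≥ 16` elements of
order `3` or `6` leave at most `8` elements of `2`-power order, which are then exactly the elements of `P`. [folklore] -/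
theorem conj_mem_sylow_two (c : G) (hG : Fintype.card G = 24) {z : G} (hz : orderOf z = 3)
    (hzn : ∃ w : G, w * z * w⁻¹ ∉ Subgroup.zpowers z) (hc2 : c * c = 1) (hc1 : c ≠ 1) (hcen : ∀ w : G, w * c = c * w)
    (P : Sylow 2 G) (g : G) {p : G} (hp : p ∈ (P : Subgroup G)) : g * p * g⁻¹ ∈ (P : Subgroup G) := by
  classical
  obtain ⟨hP8, -⟩ := card_sylow_eq_eight P (m := 3) (by rw [hG]) (by decide)
  set S : Finset G := univ.filter (fun g : G => orderOf g ∣ 8) with hS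
  set X : Finset G := univ.filter (fun g : G => orderOf g = 3) with hX
  set Y : Finset G := univ.filter (fun g : G => orderOf g = 6) with hY
  set PF : Finset G := univ.filter (fun g : G => g ∈ (P : Subgroup G)) with hPF
  have hPF8 : PF.card = 8 := by
    rw [hPF, ← Fintype.card_subtype, ← Nat.card_eq_fintype_card]
    exact hP8
  have hPS : PF ⊆ S := fun x hx => by
    rw [hPF, Finset.mem_filter] at hx
    rw [hS, Finset.mem_filter]
    exact ⟨Finset.mem_univ _, hP8 ▸ (P : Subgroup G).orderOf_dvd_natCard hx.2⟩
  have hdSX : Disjoint S X := by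
    rw [Finset.disjoint_filter]; intro x _ h1 h2; rw [h2] at h1; norm_num at h1
  have hdSY : Disjoint S Y := by
    rw [Finset.disjoint_filter]; intro x _ h1 h2; rw [h2] at h1; norm_num at h1
  have hdXY : Disjoint X Y := by
    rw [Finset.disjoint_filter]; intro x _ h1 h2; rw [h1] at h2; norm_num at h2
  have hsum : S.card + X.card + Y.card ≤ 24 := by
    rw [← Finset.card_union_of_disjoint hdSX, ← Finset.card_union_of_disjoint (Finset.disjoint_union_left.mpr ⟨hdSY, hdXY⟩), ← hG]
    exact Finset.card_le_univ _
  have hX8 : 8 ≤ X.card := eight_le_card_orderOf_eq_three hG hz hzn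
  have hY8 : 8 ≤ Y.card := eight_le_card_orderOf_eq_six c hG hz hzn hc2 hc1 hcen
  have hS8 : S.card ≤ 8 := by omega
  have hSP : PF = S := Finset.eq_of_subset_of_card_le hPS (by rw [hPF8]; exact hS8)
  have hconj : g * p * g⁻¹ ∈ S := by
    rw [hS, Finset.mem_filter]
    refine ⟨Finset.mem_univ _, ?_⟩
    rw [← MulAut.conj_apply, MulEquiv.orderOf_eq]
    exact hP8 ▸ (P : Subgroup G).orderOf_dvd_natCard hp
  rw [← hSP, hPF, Finset.mem_filter] at hconj
  exact hconj.2

/-! ## §2 Elements of order `3` -/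

omit [Fintype G] [DecidableEq G] in
/-- **An element of order `3` inverts only involutions**: `z y z⁻¹ = y⁻¹` with `z³ = 1` forces `y² = 1` (conjugating twice gives
`z⁻¹ y z = y`, so `y = z y z⁻¹ = y⁻¹`). [folklore] -/
theorem mul_self_eq_one_of_orderOf_three_of_conj_eq_inv {z y : G} (hz : orderOf z = 3) (h : z * y * z⁻¹ = y⁻¹) : y * y = 1 := by
  have hz3 : z ^ 3 = 1 := by rw [← hz, pow_orderOf_eq_one]
  have hzz : z * z = z⁻¹ := eq_inv_of_mul_eq_one_left (by rw [← pow_two, ← pow_succ, hz3])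
  have h2 : (z * z) * y * (z * z)⁻¹ = y := by
    calc (z * z) * y * (z * z)⁻¹ = z * (z * y * z⁻¹) * z⁻¹ := by group
      _ = z * y⁻¹ * z⁻¹ := by rw [h]
      _ = (z * y * z⁻¹)⁻¹ := by group
      _ = y := by rw [h, inv_inv]
  rw [hzz, inv_inv] at h2
  have h3 : z * y * z⁻¹ = y := by
    calc z * y * z⁻¹ = z * (z⁻¹ * y * z) * z⁻¹ := by rw [h2]
      _ = y := by group
  exact mul_eq_one_iff_eq_inv.mpr (h3.symm.trans h)

omit [Fintype G] [DecidableEq G] in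
/-- **An element `z` of order `3` normalising a subgroup `P` of order `8` and centralising an element `y ∈ P` of order `4` centralises `P`**:
for `x ∈ P ∖ ⟨y⟩` one has `z x z⁻¹ = x yᵐ`, and three conjugations give `x = z³ x z⁻³ = x y³ᵐ`, so `4 ∣ 3m`, `yᵐ = 1`. [folklore] -/
theorem conj_eq_self_of_centralises_orderOf_four [Finite G] {P : Subgroup G} (hP : Nat.card P = 8) {z y : G} (hz : orderOf z = 3)
    (hy : y ∈ P) (hord : orderOf y = 4) (hzP : ∀ q ∈ P, z * q * z⁻¹ ∈ P) (hzy : z * y * z⁻¹ = y) :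
    ∀ q ∈ P, z * q * z⁻¹ = q := by
  have hz3 : z ^ 3 = 1 := by rw [← hz, pow_orderOf_eq_one]
  have hc : Commute z y := mul_inv_eq_iff_eq_mul.mp hzy
  have hzyk : ∀ k : ℤ, z * y ^ k * z⁻¹ = y ^ k := fun k => by
    rw [mul_inv_eq_iff_eq_mul]; exact (hc.zpow_right k).eq
  obtain ⟨x, hxP, hxy⟩ := exists_notMem_zpowers_of_card_eight hP hord
  obtain ⟨-, -, hsplit⟩ := conj_mem_zpowers_of_card_eight hP hy hxP hord hxy
  -- `z x z⁻¹ = x yᵐ`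
  have hmem : x⁻¹ * (z * x * z⁻¹) ∈ Subgroup.zpowers y := by
    rcases hsplit _ (hzP x hxP) with h | h
    · exfalso
      apply hxy
      obtain ⟨k, hk⟩ := Subgroup.mem_zpowers_iff.mp h
      have hx : x = y ^ k := by
        calc x = z⁻¹ * (z * x * z⁻¹) * z := by group
          _ = z⁻¹ * (z * y ^ k * z⁻¹) * z := by rw [← hk, hzyk]
          _ = y ^ k := by group
      exact Subgroup.mem_zpowers_iff.mpr ⟨k, hx.symm⟩
    · exact h
  obtain ⟨m, hm4, hm⟩ := IndexTwoCyclic.exists_pow_eq_of_mem_zpowers hmem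
  rw [hord] at hm4
  have h1 : z * x * z⁻¹ = x * y ^ m := by rw [hm, mul_inv_cancel_left]
  have hzym : z * y ^ m * z⁻¹ = y ^ m := by exact_mod_cast hzyk m
  have h2 : z ^ 3 * x * (z ^ 3)⁻¹ = x * (y ^ m * y ^ m * y ^ m) := by
    calc z ^ 3 * x * (z ^ 3)⁻¹ = z * (z * (z * x * z⁻¹) * z⁻¹) * z⁻¹ := by rw [pow_succ, pow_two]; group
      _ = z * (z * (x * y ^ m) * z⁻¹) * z⁻¹ := by rw [h1]
      _ = z * ((z * x * z⁻¹) * (z * y ^ m * z⁻¹)) * z⁻¹ := by group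
      _ = z * ((x * y ^ m) * y ^ m) * z⁻¹ := by rw [h1, hzym]
      _ = (z * x * z⁻¹) * (z * y ^ m * z⁻¹) * (z * y ^ m * z⁻¹) := by group
      _ = (x * y ^ m) * y ^ m * y ^ m := by rw [h1, hzym]
      _ = x * (y ^ m * y ^ m * y ^ m) := by group
  rw [hz3, one_mul, inv_one, mul_one] at h2
  have h3 : y ^ (3 * m) = 1 := by
    rw [show 3 * m = m + m + m by ring, pow_add, pow_add]
    exact (mul_eq_left.mp h2.symm)
  have h4 : 4 ∣ 3 * m := by rw [← hord]; exact orderOf_dvd_of_pow_eq_one h3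
  have hm0 : m = 0 := by interval_cases m <;> omega
  rw [hm0, pow_zero, mul_one] at h1
  -- `P = ⟨y⟩ ∪ x⟨y⟩` is centralised
  intro q hq
  rcases hsplit q hq with h | h
  · obtain ⟨k, rfl⟩ := Subgroup.mem_zpowers_iff.mp h
    exact hzyk k
  · obtain ⟨k, hk⟩ := Subgroup.mem_zpowers_iff.mp h
    have hq' : q = x * y ^ k := by rw [hk, mul_inv_cancel_left]
    rw [hq']
    calc z * (x * y ^ k) * z⁻¹ = (z * x * z⁻¹) * (z * y ^ k * z⁻¹) := by group
      _ = x * y ^ k := by rw [h1, hzyk]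

omit [DecidableEq G] in
/-- **An element of order `3` centralising a subgroup of order `8` in a group of order `24` is central** (its centraliser has order divisible
by `8` and by `3`). [folklore] -/
theorem commute_of_centralises_card_eight (hG : Fintype.card G = 24) {P : Subgroup G} (hP : Nat.card P = 8) {z : G} (hz : orderOf z = 3)
    (hzP : ∀ q ∈ P, z * q * z⁻¹ = q) (w : G) : w * z = z * w := by
  classical
  set C := Subgroup.centralizer ({z} : Set G) with hC
  have hPC : P ≤ C := fun q hq => by
    rw [hC, Subgroup.mem_centralizer_iff]
    intro g hg
    rw [Set.mem_singleton_iff] at hg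
    subst hg
    exact mul_inv_eq_iff_eq_mul.mp (hzP q hq)
  have hzC : z ∈ C := by
    rw [hC, Subgroup.mem_centralizer_iff]
    intro g hg
    rw [Set.mem_singleton_iff] at hg
    subst hg
    rfl
  have h8 : 8 ∣ Nat.card C := hP ▸ Subgroup.card_dvd_of_le hPC
  have h3 : 3 ∣ Nat.card C := hz ▸ C.orderOf_dvd_natCard hzC
  have h24 : 24 ∣ Nat.card C := Nat.Coprime.mul_dvd_of_dvd_of_dvd (by norm_num) h8 h3
  have hCG : Nat.card C ∣ 24 := by rw [← hG, ← Nat.card_eq_fintype_card]; exact C.card_subgroup_dvd_card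
  have hCtop : C = ⊤ := by
    apply Subgroup.eq_top_of_card_eq
    rw [Nat.card_eq_fintype_card (α := G), hG]
    exact Nat.dvd_antisymm hCG h24
  have hw : w ∈ C := hCtop ▸ Subgroup.mem_top w
  rw [hC, Subgroup.mem_centralizer_iff] at hw
  exact (hw z (Set.mem_singleton z)).symm

end

end Summit.HodgeConjecture.CorCM.Census.BinaryTetrahedral
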